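import Summits.QuantumFields.GaugeBoot.TiltedBoxTwoDimOddMidAnnulus
import HarnessLib

/-!
# Reduced-half link RP on the odd square tilted box in two dimensions: the split of the Boltzmann weight (gauge-boot, L3 supplement: 2D slab gluing, reduced-half link mirror 3b/4)

HONEST FRAMING (cell `pub-gaugeboot`, page 1 of every file): the venture produces certified bounds
on lattice expectations at stated coupling, gauge group, dimension and torus size; NOT a mass gap,
NOT a continuum limit, NOT a string tension; NOT Yang–Mills-summit-bearing (barriers
`FixedCouplingUltralocality`, `PerturbativeInvisibility`). Bookkeeping for the POSITIVE two-dimensional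
result `TiltedBoxOddMidAxisRPTwoDim.lean`; it discharges nothing else.

Odd square box `ℤ^d/Γ(2P+1, 2P+1, L)`, two dimensions, link mirror `Θ_mid : x_i ↦ 1 - x_i`, REDUCED half
`{1 ≤ x_i ≤ P}` (observables `F` with `F U = F V` whenever `U`, `V` agree on the links `IsRedLink`):

* `gRed = F · e^{-βE}` (`E = redExpo`) and the integrand `hRed = g · conj(g ∘ Θ_mid)`; both are read
  off the positive links and their mirror images, so `hRed` does not see the rungs of the three annuli
  (`hRed_update_rung`, base layers `0`, `P`, `P + 1`) nor the letters of the free layer `x_i ≡ P + 1`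
  (`hRed_update_freeLetter`); measurability and bounds;
* **`boltzmann_split_red`** — `e^{-βS} conj F(ΘU) F(U) = (e^{-βN·2M})³ · hRed · ∏_{P|P+1} · ∏_{P+1|P+2} · ∏_{0|1}`
  with the three annulus products of one-plaquette weights `SlabKernel.plaqWt` (`M = 2P + 1`;
  `redExpo_configMidReflect_add` and `exp_slabSq_eq`).

References: K. Osterwalder, E. Seiler, Ann. Phys. 110 (1978) 440, §2; A. A. Migdal, Sov. Phys. JETP 42
(1975) 413.
-/

noncomputable section

open MeasureTheory Complex Function
open scoped ComplexOrder ComplexConjugate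
open Literature.MathematicalPhysics.QuantumFieldTheory (haarProbability)
open Literature.RepresentationTheory.CompactGroups

namespace Summit.QuantumFields.GaugeBoot

namespace TiltedRP

namespace TwoDim

variable {d : ℕ} {i j : Fin d} {L P N : ℕ} [NeZero L] [NeZero P]
variable {G : Type*} [Group G] [TopologicalSpace G] [IsTopologicalGroup G] [CompactSpace G]
  [MeasurableSpace G] [BorelSpace G] [SecondCountableTopology G]
variable (ρ : G →* Matrix (Fin N) (Fin N) ℂ)

/-! ## The half observable and the integrand -/

/-- The half-weighted observable `g = F · e^{-β E}` (`E = redExpo`). -/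
def gRed (β : ℝ) (F : Config (TiltedSite d i j (2 * P + 1) (2 * P + 1) L) d G → ℂ)
    (U : Config (TiltedSite d i j (2 * P + 1) (2 * P + 1) L) d G) : ℂ :=
  F U * (Real.exp (-β * redExpo ρ U) : ℂ)

/-- The integrand after the split: `h = g · conj(g ∘ Θ_mid)`. -/
def hRed (β : ℝ) (F : Config (TiltedSite d i j (2 * P + 1) (2 * P + 1) L) d G → ℂ) (hij : i ≠ j)
    (U : Config (TiltedSite d i j (2 * P + 1) (2 * P + 1) L) d G) : ℂ :=
  gRed ρ β F U * conj (gRed ρ β F (configMidReflect (tiltedUnit d i j (2 * P + 1) (2 * P + 1) L) i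
    (tiltedAxisFlip d L (2 * P + 1) hij) U))

omit [TopologicalSpace G] [IsTopologicalGroup G] [CompactSpace G] [MeasurableSpace G] [BorelSpace G]
  [SecondCountableTopology G] in
/-- `g` is read off the positive links (two dimensions). [folklore] -/
theorem gRed_eq_of_posLinks (hij : i ≠ j) (hd : ∀ k : Fin d, k = i ∨ k = j) (β : ℝ)
    {F : Config (TiltedSite d i j (2 * P + 1) (2 * P + 1) L) d G → ℂ}
    (hFo : ∀ U V : Config (TiltedSite d i j (2 * P + 1) (2 * P + 1) L) d G, (∀ l, IsRedLink l → U l = V l) → F U = F V)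
    {U V : Config (TiltedSite d i j (2 * P + 1) (2 * P + 1) L) d G} (hUV : ∀ l ∈ posBlockR d i j L P, U l = V l) :
    gRed ρ β F U = gRed ρ β F V := by
  unfold gRed
  rw [hFo U V (fun l hl => hUV l ((isRedLink_iff_mem_posBlockR hij hd l).1 hl)), redExpo_eq_of_posLinks ρ hij hd hUV]

omit [NeZero P] in
/-- `g` is measurable and bounded. [folklore] -/
theorem measurable_gRed_and_bound (hρ : Continuous ρ) (β : ℝ)
    {F : Config (TiltedSite d i j (2 * P + 1) (2 * P + 1) L) d G → ℂ} (hFm : Measurable F) {CF : ℝ}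
    (hFb : ∀ U, ‖F U‖ ≤ CF) :
    Measurable (gRed ρ β F) ∧ ∃ Cg : ℝ, ∀ U, ‖gRed ρ β F U‖ ≤ Cg := by
  obtain ⟨CE, hCE⟩ := (isCompact_univ (X := Config (TiltedSite d i j (2 * P + 1) (2 * P + 1) L) d G)).exists_bound_of_continuousOn
    (continuous_redExpo (L := L) (P := P) ρ hρ).continuousOn
  refine ⟨hFm.mul (Complex.measurable_ofReal.comp
    ((Real.continuous_exp.comp (continuous_const.mul (continuous_redExpo ρ hρ))).measurable)),
    CF * Real.exp (|β| * CE), fun U => ?_⟩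
  rw [gRed, norm_mul, Complex.norm_real, Real.norm_eq_abs, abs_of_pos (Real.exp_pos _)]
  refine mul_le_mul (hFb U) (Real.exp_le_exp.2 ?_) (Real.exp_pos _).le ((norm_nonneg _).trans (hFb U))
  calc -β * redExpo ρ U ≤ |-β * redExpo ρ U| := le_abs_self _
    _ = |β| * |redExpo ρ U| := by rw [abs_mul, abs_neg]
    _ ≤ |β| * CE := mul_le_mul_of_nonneg_left (by simpa using hCE U (Set.mem_univ _)) (abs_nonneg _)

omit [NeZero P] in
/-- `h` is measurable and bounded. [folklore] -/
theorem measurable_hRed_and_bound (hij : i ≠ j) (hρ : Continuous ρ) (β : ℝ)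
    {F : Config (TiltedSite d i j (2 * P + 1) (2 * P + 1) L) d G → ℂ} (hFm : Measurable F) {CF : ℝ}
    (hFb : ∀ U, ‖F U‖ ≤ CF) :
    Measurable (hRed ρ β F hij) ∧ ∃ Ch : ℝ, ∀ U, ‖hRed ρ β F hij U‖ ≤ Ch := by
  obtain ⟨hgm, Cg, hgb⟩ := measurable_gRed_and_bound ρ hρ β hFm hFb
  have hΘm := (measurePreserving_configMidReflect_flip_odd (L := L) (P := P) (G := G) hij).measurable
  refine ⟨hgm.mul (Complex.continuous_conj.measurable.comp (hgm.comp hΘm)), Cg * Cg, fun U => ?_⟩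
  rw [hRed, norm_mul, Complex.norm_conj]
  exact mul_le_mul (hgb U) (hgb _) (norm_nonneg _) ((norm_nonneg _).trans (hgb U))

omit [TopologicalSpace G] [IsTopologicalGroup G] [CompactSpace G] [MeasurableSpace G] [BorelSpace G]
  [SecondCountableTopology G] in
/-- `h` does not see the rungs of the three annuli (base layers `x_i ∈ {0, P, P + 1}`). [folklore] -/
theorem hRed_update_rung [DecidableEq (TiltedSite d i j (2 * P + 1) (2 * P + 1) L)] (hij : i ≠ j)
    (hd : ∀ k : Fin d, k = i ∨ k = j) (β : ℝ) {F : Config (TiltedSite d i j (2 * P + 1) (2 * P + 1) L) d G → ℂ}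
    (hFo : ∀ U V : Config (TiltedSite d i j (2 * P + 1) (2 * P + 1) L) d G, (∀ l, IsRedLink l → U l = V l) → F U = F V)
    {y : TiltedSite d i j (2 * P + 1) (2 * P + 1) L}
    (hy : (axisCoord d L (2 * P + 1) y).val = 0 ∨ (axisCoord d L (2 * P + 1) y).val = P ∨
      (axisCoord d L (2 * P + 1) y).val = P + 1) (s : ℕ)
    (U : Config (TiltedSite d i j (2 * P + 1) (2 * P + 1) L) d G) (z : G) :
    hRed ρ β F hij (update U (rungAt y s) z) = hRed ρ β F hij U := by
  unfold hRed rungAt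
  congr 1
  · exact gRed_eq_of_posLinks ρ hij hd β hFo fun l hl => update_rung_apply_of_mem hij U hy s z l hl
  · congr 1
    exact gRed_eq_of_posLinks ρ hij hd β hFo fun l hl => configMidReflect_update_rung_odd hij hd U hy s z l hl

omit [TopologicalSpace G] [IsTopologicalGroup G] [CompactSpace G] [MeasurableSpace G] [BorelSpace G]
  [SecondCountableTopology G] in
/-- `h` does not see the letters of the free layer `x_i ≡ P + 1`. [folklore] -/
theorem hRed_update_freeLetter [DecidableEq (TiltedSite d i j (2 * P + 1) (2 * P + 1) L)] (hij : i ≠ j)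
    (hd : ∀ k : Fin d, k = i ∨ k = j) (β : ℝ) {F : Config (TiltedSite d i j (2 * P + 1) (2 * P + 1) L) d G → ℂ}
    (hFo : ∀ U V : Config (TiltedSite d i j (2 * P + 1) (2 * P + 1) L) d G, (∀ l, IsRedLink l → U l = V l) → F U = F V)
    {x : TiltedSite d i j (2 * P + 1) (2 * P + 1) L} (hx : (axisCoord d L (2 * P + 1) x).val = P + 1)
    (U : Config (TiltedSite d i j (2 * P + 1) (2 * P + 1) L) d G) (z : G) :
    hRed ρ β F hij (update U (x, j) z) = hRed ρ β F hij U := by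
  unfold hRed
  congr 1
  · exact gRed_eq_of_posLinks ρ hij hd β hFo fun l hl => update_freeLetter_apply_of_mem hij U hx z l hl
  · congr 1
    exact gRed_eq_of_posLinks ρ hij hd β hFo fun l hl => configMidReflect_update_freeLetter hij hd U hx z l hl

/-! ## The split of the Boltzmann weight -/

omit [NeZero L] in
/-- The three rung layers are distinct classes. [folklore] -/
theorem rungLayers_ne :
    (0 : ZMod (2 * P + 1)) ≠ ((P : ℕ) : ZMod (2 * P + 1)) ∧
    (0 : ZMod (2 * P + 1)) ≠ ((P : ℕ) : ZMod (2 * P + 1)) + 1 ∧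
    ((P : ℕ) : ZMod (2 * P + 1)) ≠ ((P : ℕ) : ZMod (2 * P + 1)) + 1 := by
  have hP : 1 ≤ P := one_le_P
  have h1 : ((P : ℕ) : ZMod (2 * P + 1)) + 1 = ((P + 1 : ℕ) : ZMod (2 * P + 1)) := by push_cast; ring
  rw [h1]
  refine ⟨fun h => ?_, fun h => ?_, fun h => ?_⟩
  · have := (eq_natCast_iff_val_eq_odd (P := P) (by omega)).1 h; rw [ZMod.val_zero] at this; omega
  · have := (eq_natCast_iff_val_eq_odd (P := P) (by omega)).1 h; rw [ZMod.val_zero] at this; omega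
  · have := (eq_natCast_iff_val_eq_odd (P := P) (by omega)).1 h
    rw [ZMod.val_natCast, Nat.mod_eq_of_lt (by omega)] at this; omega

omit [MeasurableSpace G] [BorelSpace G] [SecondCountableTopology G] in
open scoped Classical in
/-- **The split of the Boltzmann weight of the reduced-half link mirror**:
`e^{-βS(U)} conj F(ΘU) F(U) = (e^{-βN·2M})³ · h(U) · ∏_{P|P+1} plaqWt · ∏_{P+1|P+2} plaqWt · ∏_{0|1} plaqWt`,
`M = 2P + 1`, the annuli through `y₀ = [P e_i]`, `y₀ + e_i` and `0`. [folklore] -/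
theorem boltzmann_split_red (hij : i ≠ j) (hd : ∀ k : Fin d, k = i ∨ k = j) (hρ : Continuous ρ)
    (β : ℝ) (F : Config (TiltedSite d i j (2 * P + 1) (2 * P + 1) L) d G → ℂ)
    (U : Config (TiltedSite d i j (2 * P + 1) (2 * P + 1) L) d G) :
    (Real.exp (-β * wilsonAction ρ (tiltedUnit d i j (2 * P + 1) (2 * P + 1) L) U) : ℂ) *
      (conj (F (configMidReflect (tiltedUnit d i j (2 * P + 1) (2 * P + 1) L) i (tiltedAxisFlip d L (2 * P + 1) hij) U)) * F U) =
      ((Real.exp (-β * N * (2 * (2 * P + 1))) : ℂ) * (Real.exp (-β * N * (2 * (2 * P + 1))) : ℂ) *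
          (Real.exp (-β * N * (2 * (2 * P + 1))) : ℂ)) *
        (hRed ρ β F hij U *
          (∏ t ∈ Finset.range (2 * (2 * P + 1)), SlabKernel.plaqWt (SlabKernel.wilsonWt ρ β)
              (rungAt (oddLayerSite d i j L P)) (loAt (oddLayerSite d i j L P)) (upAt (oddLayerSite d i j L P)) t U) *
          (∏ t ∈ Finset.range (2 * (2 * P + 1)), SlabKernel.plaqWt (SlabKernel.wilsonWt ρ β)
              (rungAt (oddLayerSite d i j L P + tiltedUnit d i j (2 * P + 1) (2 * P + 1) L i))
              (loAt (oddLayerSite d i j L P + tiltedUnit d i j (2 * P + 1) (2 * P + 1) L i))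
              (upAt (oddLayerSite d i j L P + tiltedUnit d i j (2 * P + 1) (2 * P + 1) L i)) t U) *
          ∏ t ∈ Finset.range (2 * (2 * P + 1)), SlabKernel.plaqWt (SlabKernel.wilsonWt ρ β)
              (rungAt (0 : TiltedSite d i j (2 * P + 1) (2 * P + 1) L)) (loAt 0) (upAt 0) t U) := by
  have hE := redExpo_configMidReflect_add (L := L) ρ hij hd hρ U
  obtain ⟨h0P, h0P1, hPP1⟩ := rungLayers_ne (P := P)
  set f : Plaq (TiltedSite d i j (2 * P + 1) (2 * P + 1) L) d → ℝ := fun p =>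
    (N : ℝ) - plaqObs ρ (tiltedUnit d i j (2 * P + 1) (2 * P + 1) L) p U with hf
  -- the three slabs are disjoint plaquette sets
  have hdisj : ∀ a b : ZMod (2 * P + 1), a ≠ b →
      Disjoint (Finset.univ.filter (SquareSlab.IsSlabPlaq (L := L) (i := i) (j := j) a))
        (Finset.univ.filter (SquareSlab.IsSlabPlaq b)) := fun a b hab => by
    rw [Finset.disjoint_filter]
    intro p _ ha hb
    exact hab (ha.2.symm.trans hb.2)
  have hsum : ∑ p ∈ Finset.univ.filter (fun p => SquareSlab.IsSlabPlaq (0 : ZMod (2 * P + 1)) p ∨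
        SquareSlab.IsSlabPlaq ((P : ℕ) : ZMod (2 * P + 1)) p ∨
        SquareSlab.IsSlabPlaq (((P : ℕ) : ZMod (2 * P + 1)) + 1) p), f p =
      (∑ p ∈ Finset.univ.filter (SquareSlab.IsSlabPlaq (axisCoord d L (2 * P + 1) (oddLayerSite d i j L P))), f p) +
      (∑ p ∈ Finset.univ.filter (SquareSlab.IsSlabPlaq (axisCoord d L (2 * P + 1)
          (oddLayerSite d i j L P + tiltedUnit d i j (2 * P + 1) (2 * P + 1) L i))), f p) +
      ∑ p ∈ Finset.univ.filter (SquareSlab.IsSlabPlaq (axisCoord d L (2 * P + 1) (0 : TiltedSite d i j (2 * P + 1) (2 * P + 1) L))), f p := by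
    rw [Finset.filter_or, Finset.filter_or,
      Finset.sum_union (Finset.disjoint_union_right.2 ⟨hdisj _ _ h0P, hdisj _ _ h0P1⟩),
      Finset.sum_union (hdisj _ _ hPP1), map_zero, axisCoord_oddLayerSite, axisCoord_oddLayerSite_add]
    ring
  have hS : -β * wilsonAction ρ (tiltedUnit d i j (2 * P + 1) (2 * P + 1) L) U =
      -β * redExpo ρ U + -β * redExpo ρ (configMidReflect (tiltedUnit d i j (2 * P + 1) (2 * P + 1) L) i
        (tiltedAxisFlip d L (2 * P + 1) hij) U) +
      ((-β * ∑ p ∈ Finset.univ.filter (SquareSlab.IsSlabPlaq (axisCoord d L (2 * P + 1) (oddLayerSite d i j L P))), f p +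
        -β * ∑ p ∈ Finset.univ.filter (SquareSlab.IsSlabPlaq (axisCoord d L (2 * P + 1)
          (oddLayerSite d i j L P + tiltedUnit d i j (2 * P + 1) (2 * P + 1) L i))), f p) +
        -β * ∑ p ∈ Finset.univ.filter (SquareSlab.IsSlabPlaq (axisCoord d L (2 * P + 1) (0 : TiltedSite d i j (2 * P + 1) (2 * P + 1) L))), f p) := by
    rw [hsum] at hE
    linear_combination β * hE
  rw [hS, Real.exp_add, Real.exp_add, Real.exp_add, Real.exp_add, Complex.ofReal_mul, Complex.ofReal_mul,
    Complex.ofReal_mul, Complex.ofReal_mul]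
  simp only [hf]
  rw [exp_slabSq_eq ρ hij hd hρ β _ U, exp_slabSq_eq ρ hij hd hρ β _ U, exp_slabSq_eq ρ hij hd hρ β _ U, hRed, gRed, gRed,
    map_mul, Complex.conj_ofReal]
  push_cast
  ring

end TwoDim

end TiltedRP

end Summit.QuantumFields.GaugeBoot

end
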